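import Summits.BirchSwinnertonDyer.BirchSwinnertonDyer.Theorems.ErratumRoadFiveNonSurjCornerTwinMuAnRhoBarInvariance
import Literature.NumberTheory.EllipticCurves.ModPCongruenceIsomorphismProofs
import HarnessLib

/-!
# Route `ErratumRoadFive` (K2), crux `NonSurjCorner` (19065), child `NonSurjCornerTwinMuAn` (item stmt-BirchSwinnertonDyer-19948):
# THE TRACE-CONGRUENCE DOOR — 19948's certificate moves along a congruence of Frobenius TRACES `a_ℓ(W₁) ≡ a_ℓ(Wd) (mod p)` off any finite set
# (cell `bsd-stepL`, WIDTH-LEVER lane B `bsd-stepL-corner5-p2` g10; `--supports stmt-BirchSwinnertonDyer-19948 --as helper`)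

WHY. The ρ̄-door of this lane (g9, `…TwinMuAnRhoBarInvariance`, p621412) moves the `μ_an = 0` certificate along an explicit `Γ_ℚ`-equivariant
isomorphism `W₁[p] ≃ Wd[p]`. What a census actually SEES is a congruence of traces: `a_ℓ(W₁) ≡ a_ℓ(Wd) (mod p)` at the good primes. For `Wd[p]`
irreducible the two are the same thing — Chebotarev + Brauer–Nesbitt, both PROVED in the tree (`exists_addEquiv_geomTorsion_of_frobeniusTrace_congr_off_finite`,
file `ModPCongruenceIsomorphismProofs`, Darmon–Diamond–Taylor Prop. 2.6 (b)). This file composes the two: the unit in which lane B counts certificates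
(a mod-`p` congruence class, enumerated by Serre level in the g10 census) is addressed by traces alone.

* §1 `NonSurjTwin.muAnZeroAt_of_frobeniusTrace_congr_mult ∕ _good` — at a pair `(Wd, p)`, `p ≥ 5`, `Wd` multiplicative at `p`, `Wd[p]` irreducible:
  the lane certificate `X11a.MuAnZeroAt Wd p` follows from the certificate of ANY globally minimal `W₁`, multiplicative (resp. good ordinary) at `p`,
  with `p ∣ a_ℓ(Wd) − a_ℓ(W₁)` at every prime `ℓ` off a finite set at which both are good (mod the EPW fact, by name).
* §2 `NonSurjTwin.twinMuAn_of_traceCongruentCertificates` — the ROUTE DECL 19948 BY NAME from the two EPW facts and «every member is trace-congruent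
  off a finite set to some certified curve»; converse bookkeeping `traceCongruentCertificates_of_twinMuAn` (take `W₁ := Wd`, `S := ∅`).

HONEST FRAMING: CONDITIONAL on the named EPW facts exactly as p621412; Chebotarev and Brauer–Nesbitt are tree theorems, not assumptions; no `sorry`,
no definition, no new named fact; 19948 is NOT closed (its `∀` over residual classes is Greenberg's Conj. 1.11 on the family); BSD is proved for no curve.
[cite: EmertonPollackWeston2006, Thm. 1 (arXiv:math/0404484 p. 2)] [cite: DarmonDiamondTaylor1995, Prop. 2.6 (b) (PDF p. 53)] [cite: GreenbergLNM1716, §1 Conj. 1.11 (p. 61)]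
-/

set_option linter.dupNamespace false -- `Summit.BirchSwinnertonDyer.BirchSwinnertonDyer` (summit = problem), tree-wide

noncomputable section

open scoped Classical MatrixGroups ModularForm

namespace Summit.BirchSwinnertonDyer.BirchSwinnertonDyer.Theorems

open CongruenceSubgroup WeierstrassCurve Literature.NumberTheory.EllipticCurves
  Literature.NumberTheory.EllipticCurves.ModularForms
  Literature.NumberTheory.EllipticCurves.Rank1Residual
  Literature.NumberTheory.EllipticCurves.GreenbergVatsal2000
  Literature.NumberTheory.EllipticCurves.EmertonPollackWeston2006
  Summit.BirchSwinnertonDyer.Rank1Residual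

/-! ### §1 The door at one member: the certificate comes from ANY trace-congruent curve -/

/-- **TRACE-CONGRUENCE DOOR, multiplicative source.** `p ≥ 5`, `Wd` multiplicative at `p` with `Wd[p]` irreducible (every member of 19948's
population); `W₁` globally minimal, multiplicative at `p`, with `p ∣ a_ℓ(Wd) − a_ℓ(W₁)` at every prime `ℓ` off a finite set `S` at which both are
good. Then the lane certificate of `W₁` gives that of `Wd`: the congruence of traces gives a `Γ_ℚ`-equivariant `W₁[p] ≃ Wd[p]` (Chebotarev +
Brauer–Nesbitt, tree theorem `exists_addEquiv_geomTorsion_of_frobeniusTrace_congr_off_finite`), and the ρ̄-door (`muAnZeroAt_of_torsionIso_mult`,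
EPW Thm. 1 with `p` in the level, named fact `hEPW`) moves the certificate. CONDITIONAL on `hEPW`.
[cite: EmertonPollackWeston2006, Thm. 1 (arXiv:math/0404484 p. 2) and Ex. 5.3.1 (p. 32)] [cite: DarmonDiamondTaylor1995, Prop. 2.6 (b) (PDF p. 53)] -/
theorem NonSurjTwin.muAnZeroAt_of_frobeniusTrace_congr_mult (hEPW : thm1_muAn_transfer_mult_of_multiplicative)
    (Wd W₁ : WeierstrassCurve ℚ) [Wd.IsElliptic] [Wd.IsGloballyMinimal] [W₁.IsElliptic]
    [W₁.IsGloballyMinimal] (p : ℕ) [Fact p.Prime] (hp : 5 ≤ p)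
    (hmult : Mult Wd p) (hirr : Irr Wd p) (hm₁ : W₁.HasMultiplicativeReductionAtPrime p)
    (S : Set ℕ) (hS : S.Finite)
    (hcong : ∀ (ℓ : ℕ) [Fact ℓ.Prime], ℓ ∉ S → Wd.HasGoodReductionAtPrime ℓ →
      W₁.HasGoodReductionAtPrime ℓ → (p : ℤ) ∣ Wd.frobeniusTrace ℓ - W₁.frobeniusTrace ℓ)
    (hμ₁ : X11a.MuAnZeroAt W₁ p) : X11a.MuAnZeroAt Wd p :=
  NonSurjTwin.muAnZeroAt_of_torsionIso_mult hEPW Wd W₁ p hp hmult hirr hm₁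
    (exists_addEquiv_geomTorsion_of_frobeniusTrace_congr_off_finite Wd W₁ p hirr S hS hcong) hμ₁

/-- **TRACE-CONGRUENCE DOOR, good-ordinary source.** Same with `W₁` GOOD ORDINARY at `p` (`GoodOrd W₁ p`) and its certificate in the Néron shape of
`thm1_muAn_transfer_mult_of_goodOrdinary` (some coefficient of `ϖ₁ · padicLFunction f₁ α` is a unit). CONDITIONAL on `hEPW`.
[cite: EmertonPollackWeston2006, Thm. 1 (arXiv:math/0404484 p. 2)] [cite: DarmonDiamondTaylor1995, Prop. 2.6 (b) (PDF p. 53)] -/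
theorem NonSurjTwin.muAnZeroAt_of_frobeniusTrace_congr_good (hEPW : thm1_muAn_transfer_mult_of_goodOrdinary)
    (Wd W₁ : WeierstrassCurve ℚ) [Wd.IsElliptic] [Wd.IsGloballyMinimal] [W₁.IsElliptic]
    [W₁.IsGloballyMinimal] (p : ℕ) [Fact p.Prime] (hp : 5 ≤ p)
    (hmult : Mult Wd p) (hirr : Irr Wd p) (hg₁ : GoodOrd W₁ p)
    (S : Set ℕ) (hS : S.Finite)
    (hcong : ∀ (ℓ : ℕ) [Fact ℓ.Prime], ℓ ∉ S → Wd.HasGoodReductionAtPrime ℓ →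
      W₁.HasGoodReductionAtPrime ℓ → (p : ℤ) ∣ Wd.frobeniusTrace ℓ - W₁.frobeniusTrace ℓ)
    (hμ₁ : ∀ [NeZero (W₁.conductorNorm ℤ)] (f₁ : CuspForm (Gamma0 (W₁.conductorNorm ℤ)) 2),
        IsNewformOf W₁ f₁ → ∀ (ϖ₁ : ℚ), (ϖ₁ : ℝ) * W₁.realPeriodRat = plusPeriod f₁ →
      ∃ n : ℕ, ‖PowerSeries.coeff n
        (PowerSeries.C (ϖ₁ : ℚ_[p]) * padicLFunction f₁ (unitRoot W₁ p : ℚ_[p]))‖ = 1) :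
    X11a.MuAnZeroAt Wd p :=
  NonSurjTwin.muAnZeroAt_of_torsionIso_good hEPW Wd W₁ p hp hmult hirr hg₁
    (exists_addEquiv_geomTorsion_of_frobeniusTrace_congr_off_finite Wd W₁ p hirr S hS hcong) @hμ₁

/-- **One landed certificate serves every trace-congruent curve** (the converse direction of use): `Wd` multiplicative at `p ≥ 5`, `Wd[p]` irreducible,
carrying the lane certificate; `W₁` globally minimal multiplicative at `p` with `p ∣ a_ℓ(Wd) − a_ℓ(W₁)` off a finite set ⟹ `W₁` carries it. CONDITIONAL
on `hEPW`. [cite: EmertonPollackWeston2006, Thm. 1 (arXiv:math/0404484 p. 2)] [cite: DarmonDiamondTaylor1995, Prop. 2.6 (b) (PDF p. 53)] -/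
theorem NonSurjTwin.muAnZeroAt_traceCongruent_of_member (hEPW : thm1_muAn_transfer_mult_of_multiplicative)
    (Wd W₁ : WeierstrassCurve ℚ) [Wd.IsElliptic] [Wd.IsGloballyMinimal] [W₁.IsElliptic]
    [W₁.IsGloballyMinimal] (p : ℕ) [Fact p.Prime] (hp : 5 ≤ p)
    (hmult : Mult Wd p) (hirr : Irr Wd p) (hm₁ : W₁.HasMultiplicativeReductionAtPrime p)
    (S : Set ℕ) (hS : S.Finite)
    (hcong : ∀ (ℓ : ℕ) [Fact ℓ.Prime], ℓ ∉ S → Wd.HasGoodReductionAtPrime ℓ →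
      W₁.HasGoodReductionAtPrime ℓ → (p : ℤ) ∣ Wd.frobeniusTrace ℓ - W₁.frobeniusTrace ℓ)
    (hμ : X11a.MuAnZeroAt Wd p) : X11a.MuAnZeroAt W₁ p :=
  NonSurjTwin.muAnZeroAt_congruent_of_member hEPW Wd W₁ p hp hmult hirr hm₁
    (exists_addEquiv_geomTorsion_of_frobeniusTrace_congr_off_finite' Wd W₁ p hirr S hS hcong) hμ

/-! ### §2 The population: 19948 from one certificate per trace-congruence class -/

/-- **19948 from trace-congruent certificates.** Modulo the two EPW facts (by name), the route decl `Theses.ErratumRoadFive.NonSurjCornerTwinMuAn`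
follows from «every member `(Wd, p)` is trace-congruent off some finite set `S` (`p ∣ a_ℓ(Wd) − a_ℓ(W₁)` at the primes `ℓ ∉ S` good for both) to SOME
globally minimal `W₁` that is EITHER multiplicative at `p` carrying the lane certificate OR good ordinary at `p` carrying the Néron-shape certificate».
The hypothesis is what a census by Serre level delivers class by class (one certified curve per mod-`p` congruence class, the class addressed by its
traces); the `∀` over classes stays OPEN (Greenberg Conj. 1.11). CONDITIONAL; nothing booked; closes: none.
[cite: EmertonPollackWeston2006, Thm. 1 (arXiv:math/0404484 p. 2)] [cite: DarmonDiamondTaylor1995, Prop. 2.6 (b)] [cite: GreenbergLNM1716, §1 Conj. 1.11 (p. 61)] -/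
theorem NonSurjTwin.twinMuAn_of_traceCongruentCertificates
    (hEPWm : thm1_muAn_transfer_mult_of_multiplicative) (hEPWg : thm1_muAn_transfer_mult_of_goodOrdinary)
    (h : ∀ (Wd : WeierstrassCurve ℚ) [Wd.IsElliptic] [Wd.IsGloballyMinimal] (p : ℕ) [Fact p.Prime],
      ClassX11a Wd p → ¬ Surj Wd p → (p = 5 ∨ p = 7) → p ∣ padicValInt p Wd.minimalDiscriminantInt →
      ∃ (W₁ : WeierstrassCurve ℚ) (_ : W₁.IsElliptic) (_ : W₁.IsGloballyMinimal) (S : Set ℕ), S.Finite ∧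
        (∀ (ℓ : ℕ) [Fact ℓ.Prime], ℓ ∉ S → Wd.HasGoodReductionAtPrime ℓ →
          W₁.HasGoodReductionAtPrime ℓ → (p : ℤ) ∣ Wd.frobeniusTrace ℓ - W₁.frobeniusTrace ℓ) ∧
        ((W₁.HasMultiplicativeReductionAtPrime p ∧ X11a.MuAnZeroAt W₁ p) ∨
         (GoodOrd W₁ p ∧
          ∀ [NeZero (W₁.conductorNorm ℤ)] (f₁ : CuspForm (Gamma0 (W₁.conductorNorm ℤ)) 2),
            IsNewformOf W₁ f₁ → ∀ (ϖ₁ : ℚ), (ϖ₁ : ℝ) * W₁.realPeriodRat = plusPeriod f₁ →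
          ∃ n : ℕ, ‖PowerSeries.coeff n
            (PowerSeries.C (ϖ₁ : ℚ_[p]) * padicLFunction f₁ (unitRoot W₁ p : ℚ_[p]))‖ = 1))) :
    Summit.BirchSwinnertonDyer.BirchSwinnertonDyer.Theses.ErratumRoadFive.NonSurjCornerTwinMuAn := by
  refine NonSurjTwin.twinMuAn_of_congruentCertificates hEPWm hEPWg fun Wd _ _ p _ hXa hns h57 hv ↦ ?_
  obtain ⟨W₁, _, _, S, hS, hcong, hW₁⟩ := h Wd p hXa hns h57 hv
  exact ⟨W₁, inferInstance, inferInstance,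
    exists_addEquiv_geomTorsion_of_frobeniusTrace_congr_off_finite Wd W₁ p hXa.2.2.2.1 S hS hcong, hW₁⟩

/-- **The converse bookkeeping**: 19948 implies the hypothesis of `twinMuAn_of_traceCongruentCertificates` (take `W₁ := Wd`, `S := ∅`, the
trivial congruence), so modulo the EPW facts 19948 is EQUIVALENT to «one certificate per trace-congruence class». [folklore] -/
theorem NonSurjTwin.traceCongruentCertificates_of_twinMuAn
    (h : Summit.BirchSwinnertonDyer.BirchSwinnertonDyer.Theses.ErratumRoadFive.NonSurjCornerTwinMuAn) :
    ∀ (Wd : WeierstrassCurve ℚ) [Wd.IsElliptic] [Wd.IsGloballyMinimal] (p : ℕ) [Fact p.Prime],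
      ClassX11a Wd p → ¬ Surj Wd p → (p = 5 ∨ p = 7) → p ∣ padicValInt p Wd.minimalDiscriminantInt →
      ∃ (W₁ : WeierstrassCurve ℚ) (_ : W₁.IsElliptic) (_ : W₁.IsGloballyMinimal) (S : Set ℕ), S.Finite ∧
        (∀ (ℓ : ℕ) [Fact ℓ.Prime], ℓ ∉ S → Wd.HasGoodReductionAtPrime ℓ →
          W₁.HasGoodReductionAtPrime ℓ → (p : ℤ) ∣ Wd.frobeniusTrace ℓ - W₁.frobeniusTrace ℓ) ∧
        ((W₁.HasMultiplicativeReductionAtPrime p ∧ X11a.MuAnZeroAt W₁ p) ∨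
         (GoodOrd W₁ p ∧
          ∀ [NeZero (W₁.conductorNorm ℤ)] (f₁ : CuspForm (Gamma0 (W₁.conductorNorm ℤ)) 2),
            IsNewformOf W₁ f₁ → ∀ (ϖ₁ : ℚ), (ϖ₁ : ℝ) * W₁.realPeriodRat = plusPeriod f₁ →
          ∃ n : ℕ, ‖PowerSeries.coeff n
            (PowerSeries.C (ϖ₁ : ℚ_[p]) * padicLFunction f₁ (unitRoot W₁ p : ℚ_[p]))‖ = 1)) := by
  intro Wd _ _ p _ hXa hns h57 hv
  refine ⟨Wd, inferInstance, inferInstance, ∅, Set.finite_empty, fun ℓ _ _ _ _ ↦ by simp, Or.inl ⟨hXa.2.2.1, ?_⟩⟩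
  intro N _ f hf ϖ hϖ
  rw [NonSurjTwin.muAn_clause_iff_allowableRoot]
  intro a L hsa hna hL
  exact h Wd p hXa hns h57 hv f hf ϖ hϖ a L hsa hna hL

end Summit.BirchSwinnertonDyer.BirchSwinnertonDyer.Theorems

end
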